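import Summits.CriticalPhenomena.PercolationContinuityZ3.Theorems.PercNearOneGluingNoHeavyLowerTailAntitheticHarris
import HarnessLib

/-!
# `NoHeavyLowerTail` (stmt-CriticalPhenomena-4575) — antithetic cluster pairs: the PIECE LEMMA
# (prim-hp-2 gen 32, MEMO-gen32 §1)

Support file (`--supports stmt-CriticalPhenomena-4575`, hull-port prover `prim-hp-2`, gen 32).  No definitions of
record, no named facts, no sorries; standard axioms.

Setting (MEMO-gen29 §3, MEMO-gen31, MEMO-gen32): a colouring `ω ⊆ Sym2 V` of the edge set `E` (`ω` red, `ωᶜ` blue);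
RED cluster of the source `s` = `openEdgeCluster (ω ∩ E) s`, BLUE cluster = `openEdgeCluster (ωᶜ ∩ E) s`; for increasing
`F, G` put `Δ(ω) = (F(red) − F(blue)) · (G(red) − G(blue))`.  The conjectured antithetic BHK inequality (SC) and its
sink-free master form (BIC) assert `0 ≤ Σ_{ω ∈ D} Δ(ω)` for certain constraint sets `D` (both clusters avoid `X`; no
vertex of `R` lies in both clusters).

THE PIECE LEMMA (MEMO-gen32 §1, new): call a family `(T S)_{S ⊆ β}` of colourings, indexed by the subsets of a finite
set of "blocks", a PIECE if (i) the red cluster of `T S` is antitone in `S` and (ii) the blue cluster of `T S` is the red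
cluster of `T Sᶜ`.  Then `0 ≤ Σ_{S ⊆ β} Δ(T S)` — Harris' inequality on the cube `Set β` for the two functions
`S ↦ F(red(T Sᶜ)) − F(red(T S))`, which are increasing and have zero sum (the involution `S ↦ Sᶜ`).  Condition (ii) holds
whenever `T S = ω⁺ ∆ ⋃_{i ∈ S} g i` for blocks `g i` partitioning `E` (`piece_blue_eq_red_compl`); condition (i) is the
combinatorial content ("sealed skeletons", MEMO-gen32 §1b; gen-31's THEOREM D is the case of one core vertex).  Consequence
(MEMO-gen32 §2): whenever the constraint set `D` is a disjoint union of pieces and of colourings with nested clusters, the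
antithetic sum over `D` is nonnegative (`sum_nonneg_of_nested`, and add the pieces).

* `Antithetic.piece_abstract` — the order-theoretic core: `Φ : Set β → α` antitone, `F, G` monotone ⇒
  `0 ≤ Σ_S (F(Φ S) − F(Φ Sᶜ))(G(Φ S) − G(Φ Sᶜ))`.
* `Antithetic.piece_sum_nonneg` — the piece lemma for red/blue edge clusters.
* `Antithetic.compl_symmDiff_inter`, `Antithetic.piece_blue_eq_red_compl` — condition (ii) for block-flip families
  (`ω ∆ U` = the colouring `ω` flipped on the edge set `U`).
* `Antithetic.delta_nonneg_of_nested` — a single colouring with nested clusters has `Δ ≥ 0`.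
[cite: VandenbergHaggstromKahn2005, §1 p. 6 ("Harris' inequality"), Thm. 1.3 (p. 6)]
-/

noncomputable section

namespace Summit.CriticalPhenomena.PercolationContinuityZ3.Theorems

open Literature.Probability.Percolation
open scoped Classical symmDiff

namespace Antithetic

section Abstract

variable {β : Type*} [Fintype β] {α : Type*} [Preorder α]

/-- **Piece lemma, order-theoretic core.**  If `Φ : Set β → α` is antitone and `F, G : α → ℝ` are monotone, then
`0 ≤ Σ_{S : Set β} (F (Φ S) − F (Φ Sᶜ)) · (G (Φ S) − G (Φ Sᶜ))`.
Proof: `a S := F(Φ Sᶜ) − F(Φ S)` and `b S := G(Φ Sᶜ) − G(Φ S)` are increasing in `S` and have zero sum (the involution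
`S ↦ Sᶜ`), so the centred Harris inequality `harris_uniform_centred` gives `0 ≤ Σ a b`, and `a b` is the summand. [folklore] -/
theorem piece_abstract (Φ : Set β → α) (hΦ : Antitone Φ) {F G : α → ℝ} (hF : Monotone F) (hG : Monotone G) :
    0 ≤ ∑ S : Set β, (F (Φ S) - F (Φ Sᶜ)) * (G (Φ S) - G (Φ Sᶜ)) := by
  have ha : Monotone fun S : Set β => F (Φ Sᶜ) - F (Φ S) := fun S S' h =>
    sub_le_sub (hF (hΦ (Set.compl_subset_compl.2 h))) (hF (hΦ h))
  have hb : Monotone fun S : Set β => G (Φ Sᶜ) - G (Φ S) := fun S S' h =>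
    sub_le_sub (hG (hΦ (Set.compl_subset_compl.2 h))) (hG (hΦ h))
  have hsum : ∀ H : α → ℝ, ∑ S : Set β, (H (Φ Sᶜ) - H (Φ S)) = 0 := by
    intro H
    rw [Finset.sum_sub_distrib, sub_eq_zero]
    exact Fintype.sum_equiv (Function.Involutive.toPerm (compl : Set β → Set β) compl_involutive)
      (fun S => H (Φ Sᶜ)) (fun S => H (Φ S)) (fun _ => rfl)
  have h := harris_uniform_centred ha hb (hsum F) (hsum G)
  refine h.trans_eq (Finset.sum_congr rfl fun S _ => ?_)
  ring

end Abstract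

section Clusters

variable {V : Type*}

/-- **The piece lemma** (MEMO-gen32 §1).  Let `T : Set β → Set (Sym2 V)` be a family of colourings indexed by the subsets
of a finite block set `β` such that (i) the red cluster `C_s(T S ∩ E)` is antitone in `S` and (ii) the blue cluster of
`T S` equals the red cluster of `T Sᶜ`.  Then for increasing `F, G`,
`0 ≤ Σ_{S} (F(C_s(T S ∩ E)) − F(C_s((T S)ᶜ ∩ E))) · (G(C_s(T S ∩ E)) − G(C_s((T S)ᶜ ∩ E)))`:
the antithetic sum over a piece is nonnegative.
[cite: VandenbergHaggstromKahn2005, §1 p. 6 ("Harris' inequality")] -/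
theorem piece_sum_nonneg {β : Type*} [Fintype β] (E : Set (Sym2 V)) (s : V) (T : Set β → Set (Sym2 V))
    (hanti : Antitone fun S => openEdgeCluster (T S ∩ E) s)
    (hblue : ∀ S, openEdgeCluster ((T S)ᶜ ∩ E) s = openEdgeCluster (T Sᶜ ∩ E) s)
    {F G : Set (Sym2 V) → ℝ} (hF : Monotone F) (hG : Monotone G) :
    0 ≤ ∑ S : Set β, (F (openEdgeCluster (T S ∩ E) s) - F (openEdgeCluster ((T S)ᶜ ∩ E) s)) *
      (G (openEdgeCluster (T S ∩ E) s) - G (openEdgeCluster ((T S)ᶜ ∩ E) s)) := by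
  have h := piece_abstract (fun S => openEdgeCluster (T S ∩ E) s) hanti hF hG
  refine h.trans_eq (Finset.sum_congr rfl fun S _ => ?_)
  simp only [hblue S]

/-- On `E`, the complement of `ω` flipped on `U` (the symmetric difference `ω ∆ U`) is `ω` flipped on `E \ U` — for any
`U'` with `U ∪ U' ⊇ E` and `U ∩ U' ∩ E = ∅`: `(ω ∆ U)ᶜ ∩ E = (ω ∆ U') ∩ E`. [folklore] -/
theorem compl_symmDiff_inter (ω U U' E : Set (Sym2 V)) (hcov : E ⊆ U ∪ U')
    (hdisj : ∀ e ∈ E, e ∈ U → e ∉ U') : (ω ∆ U)ᶜ ∩ E = (ω ∆ U') ∩ E := by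
  ext e
  simp only [Set.mem_inter_iff, Set.mem_compl_iff, Set.mem_symmDiff]
  constructor
  · rintro ⟨h1, hE⟩
    refine ⟨?_, hE⟩
    rcases hcov hE with hU | hU'
    · have : e ∉ U' := hdisj e hE hU
      tauto
    · have : e ∉ U := fun hU => hdisj e hE hU hU'
      tauto
  · rintro ⟨h1, hE⟩
    refine ⟨?_, hE⟩
    rcases hcov hE with hU | hU'
    · have : e ∉ U' := hdisj e hE hU
      tauto
    · have : e ∉ U := fun hU => hdisj e hE hU hU'
      tauto

/-- **Condition (ii) for block-flip families.**  If the blocks `g i` cover `E` and are pairwise disjoint on `E`, then for the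
family `T S = ω⁺ ∆ ⋃_{i ∈ S} g i` (flip the blocks in `S`) the complement of `T S` agrees on `E` with `T Sᶜ`; in particular
the blue cluster of `T S` is the red cluster of `T Sᶜ`. [folklore] -/
theorem piece_blue_eq_red_compl {β : Type*} (E : Set (Sym2 V)) (s : V) (ω : Set (Sym2 V)) (g : β → Set (Sym2 V))
    (hcov : E ⊆ ⋃ i, g i) (hdisj : ∀ i j, i ≠ j → ∀ e ∈ E, e ∈ g i → e ∉ g j) (S : Set β) :
    openEdgeCluster ((ω ∆ ⋃ i ∈ S, g i)ᶜ ∩ E) s = openEdgeCluster ((ω ∆ ⋃ i ∈ Sᶜ, g i) ∩ E) s := by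
  rw [compl_symmDiff_inter ω (⋃ i ∈ S, g i) (⋃ i ∈ Sᶜ, g i) E]
  · intro e he
    obtain ⟨i, hi⟩ := Set.mem_iUnion.1 (hcov he)
    by_cases hS : i ∈ S
    · exact Or.inl (Set.mem_biUnion hS hi)
    · exact Or.inr (Set.mem_biUnion (Set.mem_compl hS) hi)
  · intro e he h1 h2
    obtain ⟨i, hi, hei⟩ := Set.mem_iUnion₂.1 h1
    obtain ⟨j, hj, hej⟩ := Set.mem_iUnion₂.1 h2
    have hij : i ≠ j := fun h => hj (h ▸ hi)
    exact hdisj i j hij e he hei hej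

/-- A colouring whose two clusters are NESTED contributes a nonnegative term: if `B ⊆ A` then
`0 ≤ (F A − F B)(G A − G B)` for increasing `F, G` (and symmetrically). [folklore] -/
theorem delta_nonneg_of_nested {A B : Set (Sym2 V)} (h : B ⊆ A ∨ A ⊆ B) {F G : Set (Sym2 V) → ℝ} (hF : Monotone F)
    (hG : Monotone G) : 0 ≤ (F A - F B) * (G A - G B) := by
  rcases h with h | h
  · exact mul_nonneg (sub_nonneg.2 (hF h)) (sub_nonneg.2 (hG h))
  · have h1 : F A - F B ≤ 0 := sub_nonpos.2 (hF h)
    have h2 : G A - G B ≤ 0 := sub_nonpos.2 (hG h)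
    nlinarith

end Clusters

end Antithetic

namespace Antithetic

section Products

variable {β₁ β₂ : Type*} {α : Type*} [SemilatticeSup α]

/-- **Products of pieces are pieces** (MEMO-gen32 §1d, the factorisation over the components of `G − s`): if the red
cluster of each factor is antitone in its own flipped block set, then the red cluster of the product family — the join of
the two, indexed by the subsets of the disjoint union of the block sets — is antitone.  With `piece_abstract` this is Lemma 2 of
THEOREM F (gen 32). [folklore] -/
theorem piece_product_antitone (Φ₁ : Set β₁ → α) (Φ₂ : Set β₂ → α) (h₁ : Antitone Φ₁) (h₂ : Antitone Φ₂) :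
    Antitone fun S : Set (β₁ ⊕ β₂) => Φ₁ (Sum.inl ⁻¹' S) ⊔ Φ₂ (Sum.inr ⁻¹' S) := fun _ _ h =>
  sup_le_sup (h₁ (Set.preimage_mono h)) (h₂ (Set.preimage_mono h))

/-- The product form of the piece lemma: two antitone factors `Φ₁, Φ₂` (red clusters of two petals as functions of their own
flipped blocks) and monotone `F, G` of the join give a nonnegative antithetic sum over the product cube `Set (β₁ ⊕ β₂)`.
[folklore] -/
theorem piece_product_sum_nonneg [Fintype β₁] [Fintype β₂] (Φ₁ : Set β₁ → α) (Φ₂ : Set β₂ → α) (h₁ : Antitone Φ₁)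
    (h₂ : Antitone Φ₂) {F G : α → ℝ} (hF : Monotone F) (hG : Monotone G) :
    0 ≤ ∑ S : Set (β₁ ⊕ β₂),
      (F (Φ₁ (Sum.inl ⁻¹' S) ⊔ Φ₂ (Sum.inr ⁻¹' S)) - F (Φ₁ (Sum.inl ⁻¹' Sᶜ) ⊔ Φ₂ (Sum.inr ⁻¹' Sᶜ))) *
        (G (Φ₁ (Sum.inl ⁻¹' S) ⊔ Φ₂ (Sum.inr ⁻¹' S)) - G (Φ₁ (Sum.inl ⁻¹' Sᶜ) ⊔ Φ₂ (Sum.inr ⁻¹' Sᶜ))) :=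
  piece_abstract (fun S : Set (β₁ ⊕ β₂) => Φ₁ (Sum.inl ⁻¹' S) ⊔ Φ₂ (Sum.inr ⁻¹' S))
    (piece_product_antitone Φ₁ Φ₂ h₁ h₂) hF hG

end Products

end Antithetic

end Summit.CriticalPhenomena.PercolationContinuityZ3.Theorems
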